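import Summits.CriticalPhenomena.PercolationContinuityZ3.Theses.PercOpenSupercrit

/-!
# Birth skeleton (BC3) — crux `GoodBoxesLikelyWhenPercolating` (stmt-CriticalPhenomena-3826)

Route `route-CriticalPhenomena-PercOpenSupercrit` (sub-problem `PercolationContinuityZ3`), crux r2
`Summit.CriticalPhenomena.PercolationContinuityZ3.Theses.PercOpenSupercrit.GoodBoxesLikelyWhenPercolating`:
for every `p` with `θ_{ℤ³}(p) > 0` and every `δ > 0` some scale `n ≥ 1` has `P_p(G_n) > 1 − δ`, where
`G_n = CROSS_n ∩ UNIQ_n` is Grimmett's good-box event (Percolation 2nd ed. §7.4 p.177 (a)+(b)):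
`CROSS_n` = "B(n) has an open crossing cluster" (a vertex joined inside `B(n)` to both faces
`u_i = −n`, `v_i = n` in every direction `i`), `UNIQ_n` = "in-box uniqueness at linear scale" (any two
vertices whose open clusters inside `B(n)` have sup-diameter `≥ n` are joined inside `B(n)`).

THE LINE (= the route header's foreseen glued split "r2b / r2a", NOT DECOMPOSED YET §): cut the
crux BY CLAUSE, at a common scale.

* STUB 1 `stub_crossingClusterLikely` (r2b; XL, known in kind at EVERY percolating `p`):
  `θ(p) > 0 ⇒ ∀ δ ∃ N ∀ n ≥ N, P_p(¬ CROSS_n) < δ`. Sketch: `P_p(B(m) ↔ ∞) → 1` (`θ > 0`, ergodicity /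
  FKG); a path to `∞` from `B(m)` leaves `B(n)` through one of the six faces, the six face events are
  increasing and equiprobable under the symmetries of the cube, so by the FKG square-root trick each
  face is reached from `B(m)` inside `B(n)` with probability `≥ 1 − (1 − P_p(B(m) ↔ ∞))^{1/6}`
  (Grimmett 1999 §7.2, proof of Lemma (7.9)/(7.17)); the six face-clusters are ONE cluster inside
  `B(n)` off an event of probability `≤ n^{-c}` by uniqueness at polynomial scale `m = n^κ`, valid at
  every `p` (Cerf 2015, arXiv:1306.3105 Thm 1.2 = DuminilCopin–Kozma–Tassion 2020 Prop 1), which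
  yields one vertex joined inside `B(n)` to all six faces. For `p > p_c` it is also Grimmett Thm (7.61).
  Why it might fail: only through a typing artefact of `CROSS_n` (it is implied by Grimmett's
  `ε`-good event, refuter rreview1), not mathematically.
* STUB 2 `stub_linearUniquenessFrequently` (r2a; OPEN — LOAD-BEARING):
  `θ(p) > 0 ⇒ ∀ δ ∀ N ∃ n ≥ N, P_p(¬ UNIQ_n) < δ` — in-box uniqueness at LINEAR scale is likely along
  a sequence of scales, at the SAME `p`. Known for `p > p_c` (Grimmett Thm (7.61) via
  Grimmett–Marstrand, Pisztora 1996 / Antal–Pisztora 1996 exponential versions); open exactly at a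
  hypothetical percolating `p_c`: "the difficulty to exclude the existence of many large clusters
  avoiding each other" (arXiv:1902.03207 §1.1 Example 1 "⇒"). Stated "frequently in `n`" (`∀ N ∃ n ≥ N`),
  the weakest form that composes with STUB 1 and exactly what the crux itself yields back for `p < 1`
  (where `P_p(G_n) ≤ 1 − (1−p)^{|E(B(n))|} < 1` forces the crux's scale to grow as `δ ↓ 0`).
  Why it might fail: false iff `θ(p_c) > 0` with two-arm / many-large-cluster events persisting at
  every large scale at `p_c` (cf. van den Berg–van Engelenburg 2022 Prop 2, arXiv:2009.13337).

Composition `GoodBoxesLikelyWhenPercolating_of` (kernel-checked, no `sorry`): given `δ`, STUB 1 at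
`δ/2` gives `N`; STUB 2 at `δ/2` from `max N 1` gives a common scale `n ≥ max N 1`; then
`P_p(G_n) ≥ 1 − P_p(¬CROSS_n ∪ ¬UNIQ_n) ≥ 1 − P_p(¬CROSS_n) − P_p(¬UNIQ_n) > 1 − δ` by OUTER-measure
subadditivity (`probReal_univ`, `measureReal_mono`, `measureReal_union_le`) — no measurability of the
events is needed, which is why the stubs bound the FAILURE probabilities from above rather than the
events from below.

DISPROOF USED: none exists for this crux (`ledger crux ls stmt-CriticalPhenomena-3826`: no workfiles,
no `Disproof.lean`, no landed `Negative/` lemma, 2026-08-17); `ledger negatives` of the summit has no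
good-box / in-box-uniqueness statement. Refuter evidence `Evidence3826.lean` (rattack, 2026-08-15):
hypothesis `0 < θ(p)` is load-bearing (`P_0(G_n) = 0`) and satisfiable (`θ(1) > 0`) — both stubs keep
the hypothesis `0 < θ(p)` and are trivially true at `p = 1` only in the way the crux is.
-/

noncomputable section

namespace Summit.CriticalPhenomena.PercolationContinuityZ3.Cruxes.GoodBoxesLikelyWhenPercolating.Birth

open MeasureTheory Literature.Probability.Percolation Literature.Probability.LatticeModels
open Summit.CriticalPhenomena.PercolationContinuityZ3.Theses.PercOpenSupercrit (GoodBoxesLikelyWhenPercolating)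

/-! ## Registered stubs (signatures over existing Literature declarations, fully qualified) -/

/-- **STUB 1 `crossingClusterLikely`** (r2b; XL, known in kind): if `θ_{ℤ³}(p) > 0` then for every
`δ > 0`, for all large `n`, the probability that `B(n) = [−n,n]³` has NO open crossing cluster (no vertex
`x` joined inside `B(n)` to both faces `u_i = −n` and `v_i = n` for every direction `i`) is `< δ`.
Sources: Grimmett 1999 §7.4 p.177 (crossing cluster), Thm (7.61) p.178 (`p > p_c`); square-root trick
§7.2; Cerf 2015 (arXiv:1306.3105) Thm 1.2 / DKT 2020 (arXiv:1902.03207) Prop 1 (uniqueness at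
polynomial scale, every `p`) to merge the six face-clusters at the same `p`. -/
theorem stub_crossingClusterLikely :
    ∀ p : unitInterval, 0 < Literature.Probability.Percolation.theta (Literature.Probability.LatticeModels.zdGraph 3) 0 p →
      ∀ δ : ℝ, 0 < δ → ∃ N : ℕ, ∀ n : ℕ, N ≤ n →
        (Literature.Probability.Percolation.bondPercolation (Literature.Probability.LatticeModels.zdGraph 3) p).real
          {ω : Literature.Probability.Percolation.BondConfig (Literature.Probability.LatticeModels.Site 3) |
            ¬ ∃ x : Literature.Probability.LatticeModels.Site 3, ∀ i : Fin 3,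
              (∃ u : Literature.Probability.LatticeModels.Site 3, u i = -(n : ℤ) ∧ ω ∈ Literature.Probability.Percolation.openConnIn ↑(Literature.Probability.LatticeModels.box 3 n) x u) ∧
              (∃ v : Literature.Probability.LatticeModels.Site 3, v i = (n : ℤ) ∧ ω ∈ Literature.Probability.Percolation.openConnIn ↑(Literature.Probability.LatticeModels.box 3 n) x v)} < δ := by
  sorry

/-- **STUB 2 `linearUniquenessFrequently`** (r2a; OPEN — LOAD-BEARING): if `θ_{ℤ³}(p) > 0` then for
every `δ > 0` and every `N` there is a scale `n ≥ N` at which the probability that IN-BOX UNIQUENESS AT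
LINEAR SCALE fails (two vertices `x, y` whose open clusters inside `B(n)` both have sup-diameter `≥ n`
but which are not joined inside `B(n)`) is `< δ` — at the SAME `p`, no sprinkling. Known for `p > p_c`
(Grimmett Thm (7.61) via Grimmett–Marstrand); open at a percolating `p_c` (arXiv:1902.03207 §1.1 Ex. 1
"⇒": "many large clusters avoiding each other"). -/
theorem stub_linearUniquenessFrequently :
    ∀ p : unitInterval, 0 < Literature.Probability.Percolation.theta (Literature.Probability.LatticeModels.zdGraph 3) 0 p →
      ∀ δ : ℝ, 0 < δ → ∀ N : ℕ, ∃ n : ℕ, N ≤ n ∧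
        (Literature.Probability.Percolation.bondPercolation (Literature.Probability.LatticeModels.zdGraph 3) p).real
          {ω : Literature.Probability.Percolation.BondConfig (Literature.Probability.LatticeModels.Site 3) |
            ¬ ∀ x y : Literature.Probability.LatticeModels.Site 3,
              (∃ u v : Literature.Probability.LatticeModels.Site 3, ω ∈ Literature.Probability.Percolation.openConnIn ↑(Literature.Probability.LatticeModels.box 3 n) x u ∧ ω ∈ Literature.Probability.Percolation.openConnIn ↑(Literature.Probability.LatticeModels.box 3 n) x v ∧ ∃ i, (n : ℤ) ≤ |u i - v i|) →
              (∃ u v : Literature.Probability.LatticeModels.Site 3, ω ∈ Literature.Probability.Percolation.openConnIn ↑(Literature.Probability.LatticeModels.box 3 n) y u ∧ ω ∈ Literature.Probability.Percolation.openConnIn ↑(Literature.Probability.LatticeModels.box 3 n) y v ∧ ∃ i, (n : ℤ) ≤ |u i - v i|) →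
              ω ∈ Literature.Probability.Percolation.openConnIn ↑(Literature.Probability.LatticeModels.box 3 n) x y} < δ := by
  sorry

/-! ### Name-keyed aliases of the stub statements
`__Registered.stub_X` is the statement of `stub_X` under the registered stub's short name, so that the
native skeleton audit (`#h21_check_skeleton`: hypotheses admissible iff registered obligations / declared
stubs BY NAME) accepts `GoodBoxesLikelyWhenPercolating_of : __Registered.stub_… → … → GoodBoxesLikelyWhenPercolating`
(device of `PercolationContinuityZ3/Cruxes/BGNOffTheFloor/Lines/birth.lean`; the `@[stub]` attribute is
gate-reserved). The wiring `example`s below check alias = stub statement syntactically. -/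
namespace __Registered

/-- Alias of the statement of `stub_crossingClusterLikely`, keyed by the stub name. -/
abbrev stub_crossingClusterLikely : Prop :=
    ∀ p : unitInterval, 0 < Literature.Probability.Percolation.theta (Literature.Probability.LatticeModels.zdGraph 3) 0 p →
      ∀ δ : ℝ, 0 < δ → ∃ N : ℕ, ∀ n : ℕ, N ≤ n →
        (Literature.Probability.Percolation.bondPercolation (Literature.Probability.LatticeModels.zdGraph 3) p).real
          {ω : Literature.Probability.Percolation.BondConfig (Literature.Probability.LatticeModels.Site 3) |
            ¬ ∃ x : Literature.Probability.LatticeModels.Site 3, ∀ i : Fin 3,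
              (∃ u : Literature.Probability.LatticeModels.Site 3, u i = -(n : ℤ) ∧ ω ∈ Literature.Probability.Percolation.openConnIn ↑(Literature.Probability.LatticeModels.box 3 n) x u) ∧
              (∃ v : Literature.Probability.LatticeModels.Site 3, v i = (n : ℤ) ∧ ω ∈ Literature.Probability.Percolation.openConnIn ↑(Literature.Probability.LatticeModels.box 3 n) x v)} < δ

/-- Alias of the statement of `stub_linearUniquenessFrequently`, keyed by the stub name. -/
abbrev stub_linearUniquenessFrequently : Prop :=
    ∀ p : unitInterval, 0 < Literature.Probability.Percolation.theta (Literature.Probability.LatticeModels.zdGraph 3) 0 p →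
      ∀ δ : ℝ, 0 < δ → ∀ N : ℕ, ∃ n : ℕ, N ≤ n ∧
        (Literature.Probability.Percolation.bondPercolation (Literature.Probability.LatticeModels.zdGraph 3) p).real
          {ω : Literature.Probability.Percolation.BondConfig (Literature.Probability.LatticeModels.Site 3) |
            ¬ ∀ x y : Literature.Probability.LatticeModels.Site 3,
              (∃ u v : Literature.Probability.LatticeModels.Site 3, ω ∈ Literature.Probability.Percolation.openConnIn ↑(Literature.Probability.LatticeModels.box 3 n) x u ∧ ω ∈ Literature.Probability.Percolation.openConnIn ↑(Literature.Probability.LatticeModels.box 3 n) x v ∧ ∃ i, (n : ℤ) ≤ |u i - v i|) →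
              (∃ u v : Literature.Probability.LatticeModels.Site 3, ω ∈ Literature.Probability.Percolation.openConnIn ↑(Literature.Probability.LatticeModels.box 3 n) y u ∧ ω ∈ Literature.Probability.Percolation.openConnIn ↑(Literature.Probability.LatticeModels.box 3 n) y v ∧ ∃ i, (n : ℤ) ≤ |u i - v i|) →
              ω ∈ Literature.Probability.Percolation.openConnIn ↑(Literature.Probability.LatticeModels.box 3 n) x y} < δ

end __Registered

/-- Wiring check: the alias IS the statement of STUB 1. -/
example : __Registered.stub_crossingClusterLikely := stub_crossingClusterLikely
/-- Wiring check: the alias IS the statement of STUB 2. -/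
example : __Registered.stub_linearUniquenessFrequently := stub_linearUniquenessFrequently

/-! ## Proved plumbing: a union bound on complements (outer measure — no measurability needed) -/

/-- For a probability measure: if the failure sets of `P` and of `Q` have (outer) probability `< a` and
`< b`, then `{P ∧ Q}` has probability `> 1 − (a + b)`. Uses only monotonicity and subadditivity of
`μ.real`, so NO measurability of `{P}`, `{Q}` is required. -/
theorem one_sub_lt_measureReal_setOf_and {α : Type*} [MeasurableSpace α] (μ : Measure α)
    [IsProbabilityMeasure μ] {P Q : α → Prop} {a b : ℝ}
    (hP : μ.real {ω | ¬ P ω} < a) (hQ : μ.real {ω | ¬ Q ω} < b) :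
    1 - (a + b) < μ.real {ω | P ω ∧ Q ω} := by
  have hcover : (Set.univ : Set α) ⊆ {ω | P ω ∧ Q ω} ∪ ({ω | ¬ P ω} ∪ {ω | ¬ Q ω}) := by
    intro ω _
    by_cases hPω : P ω
    · by_cases hQω : Q ω
      · exact Or.inl ⟨hPω, hQω⟩
      · exact Or.inr (Or.inr hQω)
    · exact Or.inr (Or.inl hPω)
  have h1 : (1 : ℝ) ≤ μ.real {ω | P ω ∧ Q ω} + (μ.real {ω | ¬ P ω} + μ.real {ω | ¬ Q ω}) :=
    calc (1 : ℝ) = μ.real (Set.univ : Set α) := probReal_univ.symm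
      _ ≤ μ.real ({ω | P ω ∧ Q ω} ∪ ({ω | ¬ P ω} ∪ {ω | ¬ Q ω})) := measureReal_mono hcover
      _ ≤ μ.real {ω | P ω ∧ Q ω} + μ.real ({ω | ¬ P ω} ∪ {ω | ¬ Q ω}) := measureReal_union_le _ _
      _ ≤ μ.real {ω | P ω ∧ Q ω} + (μ.real {ω | ¬ P ω} + μ.real {ω | ¬ Q ω}) := by
          gcongr; exact measureReal_union_le _ _
  linarith

/-! ## The composition: STUB 1 → STUB 2 → crux, BY NAME -/

/-- **Composition (no `sorry`).** Crossing clusters eventually likely (STUB 1) and linear-scale in-box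
uniqueness frequently likely (STUB 2), both at the same percolating `p`, give Grimmett's good box with
probability `> 1 − δ` at a common scale `n ≥ 1`: the crux `GoodBoxesLikelyWhenPercolating` by name. -/
theorem GoodBoxesLikelyWhenPercolating_of
    (hCross : __Registered.stub_crossingClusterLikely)
    (hUniq : __Registered.stub_linearUniquenessFrequently) :
    GoodBoxesLikelyWhenPercolating := by
  intro p hp δ hδ
  obtain ⟨N, hN⟩ := hCross p hp (δ / 2) (half_pos hδ)
  obtain ⟨n, hn, hU⟩ := hUniq p hp (δ / 2) (half_pos hδ) (max N 1)
  have hC := hN n ((le_max_left N 1).trans hn)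
  refine ⟨n, (le_max_right N 1).trans hn, ?_⟩
  have h := one_sub_lt_measureReal_setOf_and
    (Literature.Probability.Percolation.bondPercolation (Literature.Probability.LatticeModels.zdGraph 3) p) hC hU
  rw [add_halves] at h
  exact h

/-- Wiring check: the registered stubs feed `GoodBoxesLikelyWhenPercolating_of` as stated. -/
example : GoodBoxesLikelyWhenPercolating :=
  GoodBoxesLikelyWhenPercolating_of stub_crossingClusterLikely stub_linearUniquenessFrequently

end Summit.CriticalPhenomena.PercolationContinuityZ3.Cruxes.GoodBoxesLikelyWhenPercolating.Birth

end
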